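import Summits.QuantumFields.BalabanUV.T4Continuum.Support.NE7PushForwardContinuity
import Summits.QuantumFields.BalabanUV.T4Continuum.Support.AveragingDeficitMultiLevelBridge
import Summits.QuantumFields.BalabanUV.T4Continuum.Support.MinimalActionCompact
import Summits.QuantumFields.BalabanUV.T4Continuum.Support.MinimalActionSandwich
import Summits.QuantumFields.BalabanUV.T4Continuum.Support.MinimalActionRate
import Mathlib.Analysis.Calculus.InverseFunctionTheorem.FDeriv
import HarnessLib

/-!
# NE7AdmissibleFibreLHC — THE ADMISSIBLE FIBRES `D ↦ {U ∈ sfClass : Q̄_{k+1}(U) = D}` ARE LOWER HEMICONTINUOUS AT INTERIOR POINTS: the `(k+1)`-fold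
# average is a SUBMERSION in the chart ([tree] row NE3-R2), hence an OPEN MAP near every interior configuration (Mathlib's
# `HasStrictFDerivAt.map_nhds_eq_of_surj`) — every datum near `Q̄_{k+1}(U₀)` is the average of a class configuration near `U₀`

Cell `pub-balaban`, rung (B)+1 sub-cell t4, lineage `b2b-balaban-t4-ne7-p1`, generation 68 (CRUX PROVER NE7 #1); hunt (h12) «(OPEN) BY MINIMISATION:
IFT leaves the bill», memo `t4/b2b-balaban-t4-ne7-p1-g68/HUNT-H12-OPEN-BY-MINIMISATION.md` §3.  File F25 (over [tree] `AveragingDeficitMultiLevelFermat`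
(`hasStrictFDerivAt_levelQ`, `levelQ'_onto`, `continuousAt_cavgIter_chart`), `AveragingDeficitTorusChart` (the chart), `MinimalActionCompact`, F17).

WHY.  The minimisation road to (OPEN) (F27) compares minimisers at a nearby datum `D` with the small critical configuration `U₀` at `D₀`; Berge's argument
needs ONE competitor admissible for `D` close to `U₀` — lower hemicontinuity of the admissible-set correspondence at `(D₀, U₀)`.  For `U₀` in the INTERIOR of
the class this is the open-mapping half of the submersion theorem for the constraint map, which row NE3-R2 proved strictly differentiable with onto
differential in the torus chart (for Fermat ∕ Lagrange).  No implicit function, no Hessian, no uniformity in `k`.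
WHAT ([folklore]; 0 def, 0 sorry).
§1 the chart as a continuous map into the product topology (`continuous_chart`), `chart id = chart skewP` on `𝔲(N)` fields;
§2 DECODING: `eq_of_skewP_mlog_eq` ∕ `eq_of_skewPR_relLog_eq` — two unitary periodic configurations bondwise within `1∕4` of `X₀` with the same `𝔲(N)` chart
   coordinates relative to `X₀` coincide (the unitary logarithm in the ball is skew, [tree] `star_mlog_eq_neg`, `exp_mlog`);
§3 the chart coordinate of the datum is continuous at the base (`tendsto_skewPR_relLog`) and nearby data are bondwise within `1∕4` (`eventually_near_base`);
§4 **`map_levelQ_chart_nhds_eq`** — on the `𝔲(N)` torus fields the constraint map `Φ ↦ levelQ k U₀ (chart U₀ Φ)` maps `𝓝 0` ONTO `𝓝 0`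
   (`hasStrictFDerivAt_levelQ` ∘ subtype inclusion, range `= ⊤` by `levelQ'_onto`, `HasStrictFDerivAt.map_nhds_eq_of_surj`);
§5 **`admissible_lhc`** — LOWER HEMICONTINUITY: `U₀ ∈ admissible (sfClass d L N ε) L (k+1) D₀` with `SmallField U₀ a`, `a < ε(L^{k+1})^{−2}` (INTERIOR) and
   `LevelSmall d L k (ε(L^{k+1})^{−2})` ⟹ for every neighbourhood `𝒰` of `U₀`, eventually for unitary `N`-periodic data `D → D₀`, SOME `U ∈ 𝒰` is admissible
   for `D`; **`admissible_lhc_param`** — the same along a data path `γ` continuous at `τ₀` within a parameter set.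
HONEST FRAMING (page 1): soft finite-dimensional calculus + kinematics; nothing is asserted about Bałaban's minimisers; NOT (OPEN), NOT ONE-STEP, NOT NE7; spine
0∕9; finite T⁴ rung (B)+1 — NOT infinite volume, NOT mass gap, NOT Clay.  Continuum YM on T⁴ ⇐ BetaPertH ∧ nine spine estimates (0/9 proved); BetaPertH ⇐
(D1) ∧ (D4) ∧ CAP+tail; G-an2-4 gates asym, D1 and NE2/3/4.
-/

set_option autoImplicit false

open scoped BigOperators Matrix Matrix.Norms.L2Operator Topology
open NormedSpace Finset Set Filter

namespace Summit.QuantumFields.BalabanUV.T4Continuum.NE7AdmissibleFibreLHC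

open Literature.MathematicalPhysics.QuantumFieldTheory.Balaban1983to89
open B7Prop1Explicit B7Prop2Explicit MatrixLog UnitaryModel
open T4AveragingDeficitWall (IsUnitaryCfg IsSkewDir SmallField vary)
open T4AveragingDeficitWallBoundary (IsPeriodicCfg periodBox)
open AveragingDeficitPeriodicCounting (IsPeriodicDir)
open AveragingDeficitTransport (mem_U1_of_unitary)
open AveragingDeficitTorusChart (TDir redN chart chartDir chart_zero skewP skewP_of_mem skewP_mem isUnitaryCfg_chart isPeriodicCfg_chart
  eq_wrap_add periodic_smul_vec)
open AveragingDeficitChartCalculus (cavg relLog relLog_self mlog_one)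
open AveragingDeficitFermat (eventually_smallField_chart)
open AveragingDeficitTwoLevelPrep (skewSub mem_skewSub skewPF skewPR skewPF_of_mem skewPF_apply)
open AveragingDeficitMultiLevelPrep (tower cavgIter levelQ levelQ' levelQ_self LevelSmall cavgIter_unitary_small isPeriodicCfg_cavgIter
  natCast_tower_succ tower_ne_zero)
open AveragingDeficitMultiLevelFermat (hasStrictFDerivAt_levelQ levelQ'_onto continuousAt_cavgIter_chart)
open AveragingDeficitMultiLevelBridge (cavgIter_eq_avgIter tower_eq)
open MinimalActionSandwich (admissible)
open MinimalActionRate (sfClass)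
open MinimalActionCompact (continuous_eval)
open NE7PushForwardContinuity (continuous_expUnit)

noncomputable section

variable {d : ℕ} {n : Type*} [Fintype n] [DecidableEq n]

/-! ## §1 The chart as a continuous map into the product topology -/

/-- **The chart `Φ ↦ V·e^{PΦ}` is continuous** from the torus fields into the product topology on configurations (any insert `P`). [folklore] -/
theorem continuous_chart (P : Matrix n n ℂ →L[ℝ] Matrix n n ℂ) (M : ℕ) [NeZero M] (V : Site d → Fin d → (Matrix n n ℂ)ˣ) :
    Continuous fun Φ : TDir d n M => chart P M V Φ := by
  refine continuous_pi fun x => continuous_pi fun κ => ?_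
  have h1 : Continuous fun Φ : TDir d n M => Φ (redN M x) κ := (continuous_apply κ).comp (continuous_apply (redN M x))
  have h2 : Continuous fun Φ : TDir d n M => expUnit (P (Φ (redN M x) κ)) := continuous_expUnit.comp (P.continuous.comp h1)
  show Continuous fun Φ : TDir d n M => V x κ * expUnit (chartDir P M Φ x κ)
  exact continuous_const.mul h2

/-- On `𝔲(N)` torus fields the full chart (insert `id`) is the unitary chart (insert `skewP`). [folklore] -/
theorem chart_id_eq_chart_skewP {M : ℕ} [NeZero M] (V : Site d → Fin d → (Matrix n n ℂ)ˣ) {Φ : TDir d n M} (hΦ : Φ ∈ skewSub d n M) :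
    chart (ContinuousLinearMap.id ℝ (Matrix n n ℂ)) M V Φ = chart skewP M V Φ := by
  funext x κ
  simp only [chart, chartDir, ContinuousLinearMap.id_apply, skewP_of_mem (hΦ (redN M x) κ)]

/-! ## §2 Decoding: equal `𝔲(N)` chart coordinates relative to a unitary base give equal unitary configurations -/

/-- For unitary `W₀, W, W′` with `|W₀⁻¹W − 1|, |W₀⁻¹W′ − 1| ≤ 1∕4`: `skewP(log(W₀⁻¹W)) = skewP(log(W₀⁻¹W′)) ⇒ W = W′` (both logarithms are skew —
[tree] `star_mlog_eq_neg` — so they coincide, and `W₀⁻¹W = exp log = W₀⁻¹W′`). [folklore] -/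
theorem eq_of_skewP_mlog_eq {W₀ W W' : (Matrix n n ℂ)ˣ} (hW₀ : W₀ ∈ unitaryUnits (Matrix n n ℂ)) (hW : W ∈ unitaryUnits (Matrix n n ℂ))
    (hW' : W' ∈ unitaryUnits (Matrix n n ℂ))
    (hnear : ‖(((W₀⁻¹ : (Matrix n n ℂ)ˣ) : Matrix n n ℂ)) * (W : Matrix n n ℂ) - 1‖ ≤ 1 / 4)
    (hnear' : ‖(((W₀⁻¹ : (Matrix n n ℂ)ˣ) : Matrix n n ℂ)) * (W' : Matrix n n ℂ) - 1‖ ≤ 1 / 4)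
    (h : skewP ((mlog ((((W₀⁻¹ : (Matrix n n ℂ)ˣ) : Matrix n n ℂ)) * (W : Matrix n n ℂ))) : Matrix n n ℂ)
      = skewP (mlog ((((W₀⁻¹ : (Matrix n n ℂ)ˣ) : Matrix n n ℂ)) * (W' : Matrix n n ℂ)))) : W = W' := by
  letI : CStarAlgebra (Matrix n n ℂ) := {}
  set X : (Matrix n n ℂ)ˣ := W₀⁻¹ * W with hX
  set X' : (Matrix n n ℂ)ˣ := W₀⁻¹ * W' with hX'
  have hXu : X ∈ unitaryUnits (Matrix n n ℂ) := (unitaryUnits _).mul_mem ((unitaryUnits _).inv_mem hW₀) hW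
  have hX'u : X' ∈ unitaryUnits (Matrix n n ℂ) := (unitaryUnits _).mul_mem ((unitaryUnits _).inv_mem hW₀) hW'
  have hXval : (X : Matrix n n ℂ) = ((W₀⁻¹ : (Matrix n n ℂ)ˣ) : Matrix n n ℂ) * (W : Matrix n n ℂ) := by rw [hX, Units.val_mul]
  have hX'val : (X' : Matrix n n ℂ) = ((W₀⁻¹ : (Matrix n n ℂ)ˣ) : Matrix n n ℂ) * (W' : Matrix n n ℂ) := by rw [hX', Units.val_mul]
  have hn : ‖(X : Matrix n n ℂ) - 1‖ ≤ 1 / 4 := by rw [hXval]; exact hnear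
  have hn' : ‖(X' : Matrix n n ℂ) - 1‖ ≤ 1 / 4 := by rw [hX'val]; exact hnear'
  have hskew : mlog (X : Matrix n n ℂ) ∈ skewAdjoint (Matrix n n ℂ) := by
    rw [skewAdjoint.mem_iff]; exact star_mlog_eq_neg (mem_unitaryUnits.mp hXu) hn
  have hskew' : mlog (X' : Matrix n n ℂ) ∈ skewAdjoint (Matrix n n ℂ) := by
    rw [skewAdjoint.mem_iff]; exact star_mlog_eq_neg (mem_unitaryUnits.mp hX'u) hn'
  have hlog : mlog (X : Matrix n n ℂ) = mlog (X' : Matrix n n ℂ) := by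
    rw [← skewP_of_mem hskew, ← skewP_of_mem hskew', hXval, hX'val]
    exact h
  have hXX' : (X : Matrix n n ℂ) = (X' : Matrix n n ℂ) := by
    rw [← exp_mlog (X := (X : Matrix n n ℂ)) (by linarith), ← exp_mlog (X := (X' : Matrix n n ℂ)) (by linarith), hlog]
  have hXX'u : X = X' := Units.ext hXX'
  calc W = W₀ * (W₀⁻¹ * W) := by group
    _ = W₀ * (W₀⁻¹ * W') := by rw [← hX, hXX'u]
    _ = W' := by group

/-- **DECODING ON THE TORUS**: unitary `M′`-periodic `X₀, X, X′` with `X`, `X′` bondwise within `1∕4` of `X₀` (relative) and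
`skewPR(relLog X₀ X) = skewPR(relLog X₀ X′)` ⟹ `X = X′`. [folklore] -/
theorem eq_of_skewPR_relLog_eq {M' : ℕ} [NeZero M'] {X₀ X X' : Site d → Fin d → (Matrix n n ℂ)ˣ}
    (hXP : IsPeriodicCfg X (M' : ℤ)) (hX'P : IsPeriodicCfg X' (M' : ℤ)) (hX₀u : IsUnitaryCfg X₀) (hXu : IsUnitaryCfg X) (hX'u : IsUnitaryCfg X')
    (hnear : ∀ (r : Fin d → Fin M') (κ : Fin d),
      ‖(((X₀ (boxVec M' r) κ)⁻¹ : (Matrix n n ℂ)ˣ) : Matrix n n ℂ) * (X (boxVec M' r) κ : Matrix n n ℂ) - 1‖ ≤ 1 / 4)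
    (hnear' : ∀ (r : Fin d → Fin M') (κ : Fin d),
      ‖(((X₀ (boxVec M' r) κ)⁻¹ : (Matrix n n ℂ)ˣ) : Matrix n n ℂ) * (X' (boxVec M' r) κ : Matrix n n ℂ) - 1‖ ≤ 1 / 4)
    (hQ : skewPR M' (relLog M' X₀ X) = skewPR M' (relLog M' X₀ X')) : X = X' := by
  have hb : ∀ (r : Fin d → Fin M') (κ : Fin d), X (boxVec M' r) κ = X' (boxVec M' r) κ := by
    intro r κ
    refine eq_of_skewP_mlog_eq (hX₀u _ _) (hXu _ _) (hX'u _ _) (hnear r κ) (hnear' r κ) ?_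
    have h := congrArg (fun Ψ : ↥(skewSub d n M') => (Ψ : TDir d n M') r κ) hQ
    simpa [skewPR, relLog] using h
  funext y κ
  rw [eq_wrap_add M' y, periodic_smul_vec (f := fun z => X z κ) (fun z i => hXP z i κ),
    periodic_smul_vec (f := fun z => X' z κ) (fun z i => hX'P z i κ)]
  exact hb _ _

/-! ## §3 The chart coordinate of the datum near the base -/

/-- `D ↦ (X₀(b))⁻¹·D(b)` is continuous (product topology). [folklore] -/
theorem continuous_relVal (X₀ : Site d → Fin d → (Matrix n n ℂ)ˣ) (x : Site d) (κ : Fin d) :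
    Continuous fun D : Site d → Fin d → (Matrix n n ℂ)ˣ => (((X₀ x κ)⁻¹ : (Matrix n n ℂ)ˣ) : Matrix n n ℂ) * (D x κ : Matrix n n ℂ) :=
  continuous_const.mul (Units.continuous_val.comp (continuous_eval x κ))

/-- **The `𝔲(N)` chart coordinate of the datum relative to `X₀` tends to `0` as the datum tends to `X₀`** (the logarithm (21) is continuous at `1`).
[folklore] -/
theorem tendsto_skewPR_relLog (M' : ℕ) (X₀ : Site d → Fin d → (Matrix n n ℂ)ˣ) :
    Tendsto (fun D : Site d → Fin d → (Matrix n n ℂ)ˣ => skewPR M' (relLog M' X₀ D)) (𝓝 X₀) (𝓝 0) := by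
  have hrel : Tendsto (fun D : Site d → Fin d → (Matrix n n ℂ)ˣ => relLog M' X₀ D) (𝓝 X₀) (𝓝 (relLog M' X₀ X₀)) := by
    refine tendsto_pi_nhds.mpr fun r => tendsto_pi_nhds.mpr fun κ => ?_
    have hc : ContinuousAt (mlog : Matrix n n ℂ → Matrix n n ℂ) 1 := (analyticAt_mlog (by simp)).continuousAt
    have hv : Tendsto (fun D : Site d → Fin d → (Matrix n n ℂ)ˣ =>
        (((X₀ (boxVec M' r) κ)⁻¹ : (Matrix n n ℂ)ˣ) : Matrix n n ℂ) * (D (boxVec M' r) κ : Matrix n n ℂ)) (𝓝 X₀) (𝓝 1) := by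
      have h := (continuous_relVal X₀ (boxVec M' r) κ).tendsto X₀
      rwa [Units.inv_mul] at h
    have h1 : relLog M' X₀ X₀ r κ = mlog 1 := by simp only [relLog, Units.inv_mul]
    rw [h1]
    exact hc.tendsto.comp hv
  rw [relLog_self] at hrel
  have h := ((skewPR (d := d) (n := n) M').continuous.tendsto 0).comp hrel
  rwa [map_zero] at h

/-- **Data near `X₀` are bondwise within `1∕4` of `X₀`** (relative; finitely many torus bonds). [folklore] -/
theorem eventually_near_base (M' : ℕ) (X₀ : Site d → Fin d → (Matrix n n ℂ)ˣ) :
    ∀ᶠ D in 𝓝 X₀, ∀ (r : Fin d → Fin M') (κ : Fin d),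
      ‖(((X₀ (boxVec M' r) κ)⁻¹ : (Matrix n n ℂ)ˣ) : Matrix n n ℂ) * (D (boxVec M' r) κ : Matrix n n ℂ) - 1‖ ≤ 1 / 4 := by
  refine Filter.eventually_all.mpr fun r => Filter.eventually_all.mpr fun κ => ?_
  have hc : Continuous fun D : Site d → Fin d → (Matrix n n ℂ)ˣ =>
      ‖(((X₀ (boxVec M' r) κ)⁻¹ : (Matrix n n ℂ)ˣ) : Matrix n n ℂ) * (D (boxVec M' r) κ : Matrix n n ℂ) - 1‖ :=
    ((continuous_relVal X₀ (boxVec M' r) κ).sub continuous_const).norm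
  have h0 : ‖(((X₀ (boxVec M' r) κ)⁻¹ : (Matrix n n ℂ)ˣ) : Matrix n n ℂ) * (X₀ (boxVec M' r) κ : Matrix n n ℂ) - 1‖ < 1 / 4 := by
    rw [Units.inv_mul, sub_self, norm_zero]; norm_num
  exact ((hc.tendsto X₀).eventually (gt_mem_nhds h0)).mono fun D hD => hD.le

/-! ## §4 The constraint map is open at interior points: `𝓝 0 ↦ 𝓝 0` on the `𝔲(N)` torus fields -/

/-- **THE `(k+1)`-FOLD AVERAGE IN THE CHART MAPS NEIGHBOURHOODS OF `0` ONTO NEIGHBOURHOODS OF `0`** (restricted to the `𝔲(N)` fields): for a unitary `U₀` of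
period `L·tower L N k` with `SmallField U₀ x`, `LevelSmall d L k x`, the map `Φ ↦ levelQ L N k U₀ (chart_id U₀ Φ)` on `skewSub` satisfies `map g (𝓝 0) = 𝓝 0`
— [tree] `hasStrictFDerivAt_levelQ` ∕ `levelQ'_onto` + Mathlib `HasStrictFDerivAt.map_nhds_eq_of_surj`. [folklore] -/
theorem map_levelQ_chart_nhds_eq [Nonempty n] {L N k : ℕ} [NeZero L] [NeZero N] (hL : 1 ≤ L) {U₀ : Site d → Fin d → (Matrix n n ℂ)ˣ} {x : ℝ}
    (hU₀ : IsUnitaryCfg U₀) (hU₀P : IsPeriodicCfg U₀ ((L : ℤ) * (tower L N k : ℕ))) (hx : 0 ≤ x) (hls : LevelSmall d L k x) (hU₀x : SmallField U₀ x) :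
    map (fun Φ : ↥(skewSub d n (L * tower L N k)) =>
        levelQ L N k U₀ (chart (ContinuousLinearMap.id ℝ (Matrix n n ℂ)) (L * tower L N k) U₀ (Φ : TDir d n (L * tower L N k))))
      (𝓝 0) = 𝓝 0 := by
  haveI : CompleteSpace ↥(skewSub d n (L * tower L N k)) := FiniteDimensional.complete ℝ _
  haveI : CompleteSpace ↥(skewSub d n N) := FiniteDimensional.complete ℝ _
  set g : ↥(skewSub d n (L * tower L N k)) → ↥(skewSub d n N) := fun Φ =>
    levelQ L N k U₀ (chart (ContinuousLinearMap.id ℝ (Matrix n n ℂ)) (L * tower L N k) U₀ (Φ : TDir d n (L * tower L N k))) with hg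
  have hQ := hasStrictFDerivAt_levelQ (d := d) (n := n) (M' := N) hL k hU₀ hU₀P hx hls hU₀x
  have hι := ((skewSub d n (L * tower L N k)).subtypeL).hasStrictFDerivAt (x := 0)
  have hcomp : HasStrictFDerivAt g ((levelQ' L N k U₀).comp (skewSub d n (L * tower L N k)).subtypeL) 0 := by
    have h := HasStrictFDerivAt.comp (0 : ↥(skewSub d n (L * tower L N k))) (by simpa using hQ) hι
    exact h
  have hrange : ((levelQ' L N k U₀).comp (skewSub d n (L * tower L N k)).subtypeL).range = ⊤ := by
    refine LinearMap.range_eq_top.mpr fun γ => ?_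
    obtain ⟨Φ, hΦs, hΦ⟩ := levelQ'_onto (d := d) (n := n) (M' := N) hL k hU₀ hU₀P hx hls hU₀x γ
    exact ⟨⟨Φ, mem_skewSub.mpr hΦs⟩, by simpa using hΦ⟩
  have h := hcomp.map_nhds_eq_of_surj hrange
  have hg0 : g 0 = 0 := by
    simp only [hg, Submodule.coe_zero, chart_zero, levelQ_self]
  rw [hg0] at h
  exact h

/-! ## §5 Lower hemicontinuity of the admissible fibres at interior points -/

omit [Fintype n] [DecidableEq n] in
/-- The level-`(k+1)` period in the two presentations: `N·L^{k+1} = L·tower L N k`. [folklore] -/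
theorem period_succ_eq (L N k : ℕ) : N * L ^ (k + 1) = L * tower L N k := by
  rw [tower_eq]; ring

/-- **LOWER HEMICONTINUITY OF THE ADMISSIBLE FIBRES AT AN INTERIOR CONFIGURATION.**  `L ≥ 1`, `ε ≥ 0`, `LevelSmall d L k (ε(L^{k+1})^{−2})`;
`U₀ ∈ admissible (sfClass d L N ε) L (k+1) D₀` with `SmallField U₀ a`, `a < ε(L^{k+1})^{−2}`.  Then for every neighbourhood `𝒰` of `U₀` (product topology),
EVENTUALLY as the datum `D → D₀`: if `D` is unitary and `N`-periodic, some `U ∈ 𝒰` is admissible for `D` (`U ∈ sfClass`, `Q̄_{k+1}(U) = D`).  Proof: §4 gives a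
`𝔲(N)` chart parameter `Φ` near `0` with `levelQ(chart Φ) =` the coordinate of `D` (§3: it is near `0`); §2 decodes to `Q̄_{k+1}(chart Φ) = D`; the chart point is
unitary, periodic, in the class radius ([tree] `eventually_smallField_chart`, INTERIORITY used here) and in `𝒰` (§1). [folklore] -/
theorem admissible_lhc [Nonempty n] {L N k : ℕ} [NeZero L] [NeZero N] (hL : 1 ≤ L) {ε a : ℝ} (hε : 0 ≤ ε)
    (hls : LevelSmall d L k (ε / ((L : ℝ) ^ (k + 1)) ^ 2)) {D₀ U₀ : Site d → Fin d → (Matrix n n ℂ)ˣ}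
    (hU₀ : U₀ ∈ admissible (sfClass d L N ε) L (k + 1) D₀) (haε : a < ε / ((L : ℝ) ^ (k + 1)) ^ 2) (hU₀a : SmallField U₀ a)
    {𝒰 : Set (Site d → Fin d → (Matrix n n ℂ)ˣ)} (h𝒰 : 𝒰 ∈ 𝓝 U₀) :
    ∀ᶠ D in 𝓝 D₀, IsUnitaryCfg D → IsPeriodicCfg D (N : ℤ) → ∃ U ∈ 𝒰, U ∈ admissible (sfClass d L N ε) L (k + 1) D := by
  set M : ℕ := L * tower L N k with hMdef
  set x : ℝ := ε / ((L : ℝ) ^ (k + 1)) ^ 2 with hxdef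
  have hx : 0 ≤ x := by rw [hxdef]; positivity
  obtain ⟨⟨hU₀u, hU₀P, hU₀x⟩, hU₀avg⟩ := hU₀
  have eP : ((N * L ^ (k + 1) : ℕ) : ℤ) = (L : ℤ) * (tower L N k : ℕ) := by rw [tower_eq]; push_cast; ring
  have ePM : ((N * L ^ (k + 1) : ℕ) : ℤ) = (M : ℤ) := by rw [hMdef]; push_cast; rw [tower_eq]; push_cast; ring
  have hU₀P' : IsPeriodicCfg U₀ ((L : ℤ) * (tower L N k : ℕ)) := by rw [← eP]; exact hU₀P
  have hU₀PM : IsPeriodicCfg U₀ (M : ℤ) := by rw [← ePM]; exact hU₀P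
  have hU₀Pt : IsPeriodicCfg U₀ ((tower L N (k + 1) : ℕ) : ℤ) := by rw [natCast_tower_succ]; exact hU₀P'
  -- the base datum `Q̄_{k+1}(U₀) = D₀`: unitary (and `N`-periodic by hypothesis on the data it is compared with)
  have hcD : cavgIter L (k + 1) U₀ = D₀ := by rw [cavgIter_eq_avgIter]; exact hU₀avg
  have hD₀u : IsUnitaryCfg D₀ := by
    obtain ⟨h, -, -⟩ := cavgIter_unitary_small hL k hU₀u hx hls hU₀x
    rwa [hcD] at h
  -- §4: the constraint map is open at `0` on the `𝔲(N)` fields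
  set g : ↥(skewSub d n M) → ↥(skewSub d n N) := fun Φ =>
    levelQ L N k U₀ (chart (ContinuousLinearMap.id ℝ (Matrix n n ℂ)) M U₀ (Φ : TDir d n M)) with hg
  have hmap : map g (𝓝 0) = 𝓝 0 := map_levelQ_chart_nhds_eq (N := N) (k := k) hL hU₀u hU₀P' hx hls hU₀x
  -- the chart on the `𝔲(N)` fields: continuous, through `U₀` at `0`
  set ch : ↥(skewSub d n M) → (Site d → Fin d → (Matrix n n ℂ)ˣ) := fun Φ =>
    chart (ContinuousLinearMap.id ℝ (Matrix n n ℂ)) M U₀ (Φ : TDir d n M) with hch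
  have hchc : Continuous ch := (continuous_chart (ContinuousLinearMap.id ℝ (Matrix n n ℂ)) M U₀).comp continuous_subtype_val
  have hch0 : ch 0 = U₀ := by simp only [hch, Submodule.coe_zero, chart_zero]
  have hval0 : Tendsto (fun Φ : ↥(skewSub d n M) => (Φ : TDir d n M)) (𝓝 0) (𝓝 0) := by
    have h := continuous_subtype_val.tendsto (0 : ↥(skewSub d n M))
    rwa [Submodule.coe_zero] at h
  -- the good chart parameters: image in `𝒰`, in the class radius, top average bondwise near `D₀`
  have hV1 : ∀ᶠ Φ : ↥(skewSub d n M) in 𝓝 0, ch Φ ∈ 𝒰 := by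
    have h := hchc.tendsto (0 : ↥(skewSub d n M))
    rw [hch0] at h
    exact h h𝒰
  have hV2 : ∀ᶠ Φ : ↥(skewSub d n M) in 𝓝 0, SmallField (ch Φ) x :=
    hval0.eventually (eventually_smallField_chart (ContinuousLinearMap.id ℝ (Matrix n n ℂ)) M hU₀PM haε hU₀a)
  have hV3' : ∀ᶠ θ : TDir d n M in 𝓝 0, ∀ (r : Fin d → Fin N) (κ : Fin d),
      ‖(((D₀ (boxVec N r) κ)⁻¹ : (Matrix n n ℂ)ˣ) : Matrix n n ℂ)
        * (cavgIter L (k + 1) (chart (ContinuousLinearMap.id ℝ (Matrix n n ℂ)) M U₀ θ) (boxVec N r) κ : Matrix n n ℂ) - 1‖ ≤ 1 / 4 := by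
    refine Filter.eventually_all.mpr fun r => Filter.eventually_all.mpr fun κ => ?_
    have hc0 := continuousAt_cavgIter_chart (d := d) (n := n) hL N k (ContinuousLinearMap.id ℝ (Matrix n n ℂ)) hU₀u hU₀P' hx hls hU₀x (boxVec N r) κ
    have hc : ContinuousAt (fun θ : TDir d n M =>
        ‖(((D₀ (boxVec N r) κ)⁻¹ : (Matrix n n ℂ)ˣ) : Matrix n n ℂ)
          * ((cavgIter L (k + 1) (chart (ContinuousLinearMap.id ℝ (Matrix n n ℂ)) M U₀ θ) (boxVec N r) κ : (Matrix n n ℂ)ˣ) : Matrix n n ℂ) - 1‖) 0 :=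
      ((continuousAt_const.mul hc0).sub continuousAt_const).norm
    have h0 : ‖(((D₀ (boxVec N r) κ)⁻¹ : (Matrix n n ℂ)ˣ) : Matrix n n ℂ)
        * ((cavgIter L (k + 1) (chart (ContinuousLinearMap.id ℝ (Matrix n n ℂ)) M U₀ 0) (boxVec N r) κ : (Matrix n n ℂ)ˣ) : Matrix n n ℂ) - 1‖ < 1 / 4 := by
      rw [chart_zero, hcD, Units.inv_mul, sub_self, norm_zero]
      norm_num
    exact (hc.eventually (gt_mem_nhds h0)).mono fun θ hθ => hθ.le
  have hV3 : ∀ᶠ Φ : ↥(skewSub d n M) in 𝓝 0, ∀ (r : Fin d → Fin N) (κ : Fin d),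
      ‖(((D₀ (boxVec N r) κ)⁻¹ : (Matrix n n ℂ)ˣ) : Matrix n n ℂ) * (cavgIter L (k + 1) (ch Φ) (boxVec N r) κ : Matrix n n ℂ) - 1‖ ≤ 1 / 4 :=
    hval0.eventually hV3'
  obtain ⟨𝒱, h𝒱, h𝒱sub⟩ : ∃ 𝒱 ∈ 𝓝 (0 : ↥(skewSub d n M)), ∀ Φ ∈ 𝒱, ch Φ ∈ 𝒰 ∧ SmallField (ch Φ) x ∧ ∀ (r : Fin d → Fin N) (κ : Fin d),
      ‖(((D₀ (boxVec N r) κ)⁻¹ : (Matrix n n ℂ)ˣ) : Matrix n n ℂ) * (cavgIter L (k + 1) (ch Φ) (boxVec N r) κ : Matrix n n ℂ) - 1‖ ≤ 1 / 4 :=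
    Filter.Eventually.exists_mem ((hV1.and hV2).and hV3 |>.mono fun Φ h => ⟨h.1.1, h.1.2, h.2⟩)
  -- its image under `g` is a neighbourhood of `0`; the datum's coordinate tends to `0`
  have hgV : g '' 𝒱 ∈ 𝓝 (0 : ↥(skewSub d n N)) := by rw [← hmap]; exact image_mem_map h𝒱
  have hcoord : ∀ᶠ D in 𝓝 D₀, skewPR N (relLog N D₀ D) ∈ g '' 𝒱 := tendsto_skewPR_relLog (d := d) (n := n) N D₀ hgV
  have hnear := eventually_near_base (d := d) (n := n) N D₀
  filter_upwards [hcoord, hnear] with D hD hDnear hDu hDP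
  obtain ⟨Φ, hΦ𝒱, hgΦ⟩ := hD
  obtain ⟨hΦ𝒰, hΦx, hΦnear⟩ := h𝒱sub Φ hΦ𝒱
  refine ⟨ch Φ, hΦ𝒰, ?_⟩
  -- the chart point is in the class
  have hΦs : (Φ : TDir d n M) ∈ skewSub d n M := Φ.2
  have hchu : IsUnitaryCfg (ch Φ) := by
    show IsUnitaryCfg (chart (ContinuousLinearMap.id ℝ (Matrix n n ℂ)) M U₀ (Φ : TDir d n M))
    rw [chart_id_eq_chart_skewP U₀ hΦs]
    exact isUnitaryCfg_chart M hU₀u _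
  have hchP : IsPeriodicCfg (ch Φ) ((N * L ^ (k + 1) : ℕ) : ℤ) := by
    rw [ePM]
    exact isPeriodicCfg_chart (ContinuousLinearMap.id ℝ (Matrix n n ℂ)) M hU₀PM _
  have hmem : ch Φ ∈ sfClass d L N ε (k + 1) := ⟨hchu, hchP, hΦx⟩
  refine ⟨hmem, ?_⟩
  -- decoding: the top average of the chart point is `D`
  have hchPt : IsPeriodicCfg (ch Φ) ((tower L N (k + 1) : ℕ) : ℤ) := by
    rw [natCast_tower_succ, ← eP]; exact hchP
  obtain ⟨hXu, -, -⟩ := cavgIter_unitary_small hL k hchu hx hls hΦx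
  have hXP : IsPeriodicCfg (cavgIter L (k + 1) (ch Φ)) (N : ℤ) := isPeriodicCfg_cavgIter L N (k + 1) hchPt
  have hQ : skewPR N (relLog N (cavgIter L (k + 1) U₀) (cavgIter L (k + 1) (ch Φ))) = skewPR N (relLog N D₀ D) := hgΦ
  rw [hcD] at hQ
  have heq : cavgIter L (k + 1) (ch Φ) = D := eq_of_skewPR_relLog_eq hXP hDP hD₀u hXu hDu hΦnear hDnear hQ
  rw [← cavgIter_eq_avgIter]
  exact heq

/-- **LOWER HEMICONTINUITY ALONG A DATA PATH** (the form F27 consumes): `γ` continuous at `τ₀` within `S` with unitary `N`-periodic values on `S`, `U₀` an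
INTERIOR admissible configuration for `γ τ₀` ⟹ for every neighbourhood `𝒰` of `U₀`, eventually for `τ → τ₀` in `S`, SOME `U ∈ 𝒰` is admissible for `γ τ`.
[folklore] -/
theorem admissible_lhc_param [Nonempty n] {L N k : ℕ} [NeZero L] [NeZero N] (hL : 1 ≤ L) {ε a : ℝ} (hε : 0 ≤ ε)
    (hls : LevelSmall d L k (ε / ((L : ℝ) ^ (k + 1)) ^ 2)) {P : Type*} [TopologicalSpace P] {S : Set P} {γ : P → (Site d → Fin d → (Matrix n n ℂ)ˣ)}
    {τ₀ : P} (hγ : ContinuousWithinAt γ S τ₀) (hγu : ∀ τ ∈ S, IsUnitaryCfg (γ τ)) (hγP : ∀ τ ∈ S, IsPeriodicCfg (γ τ) (N : ℤ))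
    {U₀ : Site d → Fin d → (Matrix n n ℂ)ˣ} (hU₀ : U₀ ∈ admissible (sfClass d L N ε) L (k + 1) (γ τ₀))
    (haε : a < ε / ((L : ℝ) ^ (k + 1)) ^ 2) (hU₀a : SmallField U₀ a) {𝒰 : Set (Site d → Fin d → (Matrix n n ℂ)ˣ)} (h𝒰 : 𝒰 ∈ 𝓝 U₀) :
    ∀ᶠ τ in 𝓝[S] τ₀, ∃ U ∈ 𝒰, U ∈ admissible (sfClass d L N ε) L (k + 1) (γ τ) := by
  have h := hγ.tendsto.eventually (admissible_lhc (N := N) hL hε hls hU₀ haε hU₀a h𝒰)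
  filter_upwards [h, self_mem_nhdsWithin] with τ hτ hτS
  exact hτ (hγu τ hτS) (hγP τ hτS)

end

end Summit.QuantumFields.BalabanUV.T4Continuum.NE7AdmissibleFibreLHC
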